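import Literature.Topology.FourManifolds.CorkDecomposition
import Literature.Topology.FourManifolds.ThetaFour
import Literature.Topology.FourManifolds.SphereSimplyConnected
import HarnessLib

/-!
# Cork presentation of homotopy 4-spheres with compact smooth exterior (`Θ₄ = 0` + the cork theorem)

Topic `Literature/Topology/FourManifolds` (cite item for route `SmoothPoincare4/PscCorkFillIn`,
hypothesis (F1) of its Assembly).

**Statement (F1).** Every homotopy 4-sphere `Σ` is obtained from the standard `S⁴` by a cork twist
with compact smooth exterior: there are a compact contractible smooth 4-manifold with boundary `C`
(boundary datum `bC`), a compact smooth 4-manifold with boundary `W` (boundary datum `bW`) — both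
Hausdorff and second countable — and diffeomorphisms `φ : ∂C ≅ ∂W`, `τ : ∂C ≅ ∂C` with
`S⁴ = C ∪_φ W` and `Σ = C ∪_{φ ∘ τ} W` (`IsBoundaryGluing`).

This is NOT a new named fact: it is **proved here** (`HomotopySphere.exists_corkPresentation_of_facts`)
from the two named facts of the tree it combines, taken as hypotheses —

* `Θ₄ = 0` (Kervaire–Milnor 1963, table p. 504; `Literature.Topology.FourManifolds.isHCobordant_sphere_of_homotopySphere_four`,
  file `ThetaFour`): every homotopy 4-sphere is h-cobordant to `S⁴`; and
* the **cork decomposition theorem in Matveyev's printed two-piece form**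
  (`Literature.Topology.FourManifolds.Matveyev1996_decomposition`, file `CorkDecomposition`; Matveyev, J. Differential
  Geom. 44 (1996), Theorem, parts 1–2; Curtis–Freedman–Hsiang–Stong, Invent. Math. 123 (1996),
  Theorem): h-cobordant simply connected closed smooth 4-manifolds are `M₁ = W₁ ∪_{φ₁} M`,
  `M₂ = W₂ ∪_{φ₂} M` with `Wᵢ` compact contractible, `W₁ ≅ W₂`, and — the point of (F1) — the
  common exterior `M` recorded as a compact smooth (Hausdorff, second countable) 4-manifold with
  boundary, which the one-piece fact `Literature.Topology.FourManifolds.corkDecomposition` / `IsCorkTwist` forgets,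

together with the tree's theorem `π₁(S⁴) = 1` (`simplyConnectedSpace_sphere_four_holds`, Hatcher
Prop. 1.14) transported along `Σ ≃ₕ S⁴` (Mathlib `ContinuousMap.HomotopyEquiv.simplyConnectedSpace`).
The passage from the two-piece to the one-piece form is that of
`Literature.Topology.FourManifolds.corkDecomposition_of_matveyev1996`: `C = W₁`, `W = M`, `φ = φ₁`, and the twist
`τ = ∂g ≫ φ₂ ≫ φ₁⁻¹` for the diffeomorphism `g : W₁ ≅ W₂`, the second gluing being transported
along `g` (`IsBoundaryGluing.transfer`, `BoundaryData.restrictDiffeomorph`).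

No definition is introduced (net debt `0`); users of (F1) take
`(hΘ : isHCobordant_sphere_of_homotopySphere_four) (hM : Matveyev1996_decomposition.{0})` and apply
the theorem.

## References

* M. Kervaire, J. Milnor, *Groups of homotopy spheres: I*, Ann. of Math. 77 (1963) 504–537, table
  p. 504 (`Θ₄ = 0`). [KervaireMilnorAnnals1963]
* R. Matveyev, *A decomposition of smooth simply-connected h-cobordant 4-manifolds*, J. Differential
  Geom. 44 (1996) 571–582, Theorem (parts 1–2). [Matveyev1996]
* C. L. Curtis, M. H. Freedman, W.-C. Hsiang, R. Stong, *A decomposition theorem for h-cobordant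
  smooth simply-connected compact 4-manifolds*, Invent. Math. 123 (1996) 343–348, Theorem.
  [CurtisFreedmanHsiangStong1996]
* A. Hatcher, *Algebraic Topology* (2002), Prop. 1.14, Prop. 1.18. [HatcherAT2002]
-/

open scoped Manifold ContDiff Topology
open Set Function

noncomputable section

namespace Literature.Topology.FourManifolds

/-- **Cork presentation of homotopy 4-spheres with compact smooth exterior** (hypothesis (F1) of
route `SmoothPoincare4/PscCorkFillIn`, verbatim), GIVEN `Θ₄ = 0`
(`isHCobordant_sphere_of_homotopySphere_four`, Kervaire–Milnor 1963) and the cork decomposition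
theorem in Matveyev's two-piece form (`Matveyev1996_decomposition`, Matveyev 1996 /
Curtis–Freedman–Hsiang–Stong 1996): for every homotopy 4-sphere `Σ` there are a compact
contractible smooth `C⁴` with boundary datum `bC`, a compact smooth `W⁴` with boundary datum `bW`
(both Hausdorff, second countable), `φ : ∂C ≅ ∂W` and `τ : ∂C ≅ ∂C` with `S⁴ = C ∪_φ W` and
`Σ = C ∪_{φ ∘ τ} W`. Proof: `Σ` is simply connected (`π₁(S⁴) = 1` transported along `Σ ≃ₕ S⁴`)
and h-cobordant to `S⁴` (`Θ₄ = 0`), so Matveyev gives `S⁴ = W₁ ∪_{φ₁} M`, `Σ = W₂ ∪_{φ₂} M`,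
`g : W₁ ≅ W₂`; take `C = W₁`, `W = M`, `φ = φ₁`, `τ = ∂g ≫ φ₂ ≫ φ₁⁻¹` and transport the second
gluing along `g`. [cite: Matveyev1996, Theorem (parts 1–2)]
[cite: KervaireMilnorAnnals1963, table p. 504 (Θ₄ = 0)] [cite: CurtisFreedmanHsiangStong1996, Theorem] -/
theorem HomotopySphere.exists_corkPresentation_of_facts
    (hΘ : isHCobordant_sphere_of_homotopySphere_four) (hM : Matveyev1996_decomposition.{0}) :
    ∀ S : HomotopySphere 4, ∃ (C : Type) (_ : TopologicalSpace C) (_ : T2Space C)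
      (_ : SecondCountableTopology C) (_ : ChartedSpace (EuclideanHalfSpace 4) C)
      (_ : IsManifold (𝓡∂ 4) ∞ C) (_ : CompactSpace C) (_ : ContractibleSpace C)
      (bC : BoundaryData (𝓡∂ 4) C (𝓡 3))
      (W : Type) (_ : TopologicalSpace W) (_ : T2Space W) (_ : SecondCountableTopology W)
      (_ : ChartedSpace (EuclideanHalfSpace 4) W) (_ : IsManifold (𝓡∂ 4) ∞ W) (_ : CompactSpace W)
      (bW : BoundaryData (𝓡∂ 4) W (𝓡 3))
      (φ : bC.carrier ≃ₘ⟮𝓡 3, 𝓡 3⟯ bW.carrier) (τ : bC.carrier ≃ₘ⟮𝓡 3, 𝓡 3⟯ bC.carrier),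
      IsBoundaryGluing bC bW φ (𝓡 4) (Metric.sphere (0 : EuclideanSpace ℝ (Fin 5)) 1) ∧
        IsBoundaryGluing bC bW (τ.trans φ) (𝓡 4) S.carrier := by
  intro S
  obtain ⟨e⟩ := S.nonempty_homotopyEquiv
  haveI : SimplyConnectedSpace (Metric.sphere (0 : EuclideanSpace ℝ (Fin 5)) 1) :=
    simplyConnectedSpace_sphere_four_holds
  haveI : SimplyConnectedSpace S.carrier := e.simplyConnectedSpace
  have hcob : Literature.Topology.FourManifolds.IsHCobordant 4
      (Metric.sphere (0 : EuclideanSpace ℝ (Fin 5)) 1) S.carrier :=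
    (hΘ S).symm
  obtain ⟨W₁, W₂, M, _, _, _, _, _, _, _, _, _, _, _, _, _, _, _, b₁, b₂, bM, φ₁, φ₂, hc₁, hk₁, -,
    -, hcM, hX₁, hX₂, ⟨g⟩⟩ := hM (Metric.sphere (0 : EuclideanSpace ℝ (Fin 5)) 1) S.carrier hcob
  refine ⟨W₁, ‹_›, ‹_›, ‹_›, ‹_›, ‹_›, hc₁, hk₁, b₁, M, ‹_›, ‹_›, ‹_›, ‹_›, ‹_›, hcM, bM, φ₁,
    (b₁.restrictDiffeomorph b₂ g).trans (φ₂.trans φ₁.symm), hX₁, ?_⟩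
  exact isBoundaryGluing_congr (fun z => by simp) (hX₂.transfer g)

/-- The same presentation packaged as a **cork twist** of `S⁴` in the sense of
`Literature.Topology.FourManifolds.IsCorkTwist` (forgetting the exterior's instances), GIVEN the
two facts: every homotopy 4-sphere is a cork twist of `S⁴` along a compact contractible `C`.
[cite: Matveyev1996, Theorem (parts 1–2)] [cite: KervaireMilnorAnnals1963, table p. 504 (Θ₄ = 0)] -/
theorem HomotopySphere.exists_isCorkTwist_sphere_of_facts
    (hΘ : isHCobordant_sphere_of_homotopySphere_four) (hM : Matveyev1996_decomposition.{0})
    (S : HomotopySphere 4) :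
    ∃ (C : Type) (_ : TopologicalSpace C) (_ : T2Space C) (_ : SecondCountableTopology C)
      (_ : ChartedSpace (EuclideanHalfSpace 4) C) (_ : IsManifold (𝓡∂ 4) ∞ C)
      (bC : BoundaryData (𝓡∂ 4) C (𝓡 3)) (τ : bC.carrier ≃ₘ⟮𝓡 3, 𝓡 3⟯ bC.carrier),
      CompactSpace C ∧ ContractibleSpace C ∧
        IsCorkTwist bC τ (𝓡 4) (Metric.sphere (0 : EuclideanSpace ℝ (Fin 5)) 1) (𝓡 4) S.carrier := by
  obtain ⟨C, _, _, _, _, _, hc, hk, bC, W, _, _, _, _, _, _, bW, φ, τ, h₁, h₂⟩ :=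
    HomotopySphere.exists_corkPresentation_of_facts hΘ hM S
  exact ⟨C, ‹_›, ‹_›, ‹_›, ‹_›, ‹_›, bC, τ, hc, hk, IsCorkTwist.of_isBoundaryGluing bW φ h₁ h₂⟩

end Literature.Topology.FourManifolds

end
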